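import Summits.AtomisticToContinuum.Crystallization.Theorems.PalmUnimodularRigidityLayeredLawsSelectHcpKuhnChartCut
import Summits.AtomisticToContinuum.Crystallization.Theorems.PalmUnimodularRigidityLayeredLawsSelectHcpGoodCentre
import Summits.AtomisticToContinuum.Crystallization.Theorems.PalmUnimodularRigidityLayeredLawsSelectHcpThresholdInterpolation

/-!
# Crux `LayeredLawsSelectHcp` (stmt-AtomisticToContinuum-9226), line `mtp-prestress-split-ergodic-frame`:
# the threshold (Kuhn–Freudenthal) interpolation of a tube chart (`stub_chartInterpolation`, T4)

The registered stub `stub_chartInterpolation` (lead c4): a rooted labelled chart `X` of an everywhere-good hcp-charted `S`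
extends to `F : ℝ³ → ℝ³` with `F (Pᵢ u) = X u` and, on every ball of radius `1/25`, a one-star similarity `a • A`
(`a ≥ 9/10`) with `‖(F p − F q) − a • (A p − A q)‖ ≤ (3/8) a ‖p − q‖`.  Assembled from the landed T1
`stub_thresholdInterpolation` (p172713), T2 `stub_goodCentre` (p172612), T3 `stub_chartCubeFrames` (p172552) over the
vocabulary of `…KuhnChartDefs` / `…KuhnChartCut`:
* `pair_bound` — pairs of Kuhn-star labels are `2 c₂ a`-close in the frame of the centre (T3);
* `slab_estimate` — the estimate for pairs in one closed slab of a good box (T1 (ii) with `M = a • A ∘ slabLin s`);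
* `stub_chartInterpolation` — vertex values (T1 (i)), good box (T2), one cut between the two slabs of the box.

All `[folklore]`.
-/

noncomputable section

namespace Summit.AtomisticToContinuum.Crystallization.Theorems.PalmUnimodularRigidity.LayeredLawsSelectHcp

open MeasureTheory Set
open Literature.MathematicalPhysics.StatisticalMechanics Literature.Geometry.DiscreteGeometry
open Summit.AtomisticToContinuum.Crystallization.Theorems.LayeredLawsSelectHcp.Negative.DiracLaws (GoodShell)

namespace KuhnChart

/-- **Pairs of Kuhn-star labels are `2 c₂ a`-close in the frame of the centre.**  For label triples `v, v'` that are
vertices of the slab `k` and whose offsets from `m` lie in `{0,1}³ ∪ {−1,0}³`, the chart values minus the reference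
similarity `a • A ∘ L_s` of the Kuhn coordinates differ by at most `2 c₂ a` (T3 at `c = kuhnLabel m`, through
`kuhnLabel_offset_mem` and `slabMap_intCast`). [folklore] -/
theorem pair_bound {X : ℤ × ℤ × ℤ → EuclideanSpace ℝ (Fin 3)} {a : ℝ}
    {A : EuclideanSpace ℝ (Fin 3) ≃ₗᵢ[ℝ] EuclideanSpace ℝ (Fin 3)} {m : ℤ × ℤ × ℤ}
    (hA : ∀ u ∈ ballLabels 2,
      ‖X (labelShift (kuhnLabel m) u) - X (kuhnLabel m) -
          a • A (hcpSite 1 (Real.sqrt (2 / 3)) (labelShift (kuhnLabel m) u) -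
            hcpSite 1 (Real.sqrt (2 / 3)) (kuhnLabel m))‖ ≤ 758 / 10000 * a)
    {k : ℤ} (v v' : ℤ × ℤ × ℤ) (hvk : v.1 = k ∨ v.1 = k + 1) (hvk' : v'.1 = k ∨ v'.1 = k + 1)
    (hσ : (((v - m).1 = 0 ∨ (v - m).1 = 1) ∧ ((v - m).2.1 = 0 ∨ (v - m).2.1 = 1) ∧
        ((v - m).2.2 = 0 ∨ (v - m).2.2 = 1)) ∨
      (((v - m).1 = 0 ∨ (v - m).1 = -1) ∧ ((v - m).2.1 = 0 ∨ (v - m).2.1 = -1) ∧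
        ((v - m).2.2 = 0 ∨ (v - m).2.2 = -1)))
    (hσ' : (((v' - m).1 = 0 ∨ (v' - m).1 = 1) ∧ ((v' - m).2.1 = 0 ∨ (v' - m).2.1 = 1) ∧
        ((v' - m).2.2 = 0 ∨ (v' - m).2.2 = 1)) ∨
      (((v' - m).1 = 0 ∨ (v' - m).1 = -1) ∧ ((v' - m).2.1 = 0 ∨ (v' - m).2.1 = -1) ∧
        ((v' - m).2.2 = 0 ∨ (v' - m).2.2 = -1))) :
    ‖(X (kuhnLabel v) - a • A (slabLin (1 - 2 * ((k % 2 : ℤ) : ℝ)) ((v.1 : ℝ), (v.2.1 : ℝ), (v.2.2 : ℝ)))) -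
        (X (kuhnLabel v') - a • A (slabLin (1 - 2 * ((k % 2 : ℤ) : ℝ)) ((v'.1 : ℝ), (v'.2.1 : ℝ), (v'.2.2 : ℝ))))‖ ≤
      2 * (758 / 10000) * a := by
  set c := kuhnLabel m with hc
  obtain ⟨u, hu, hequ⟩ := kuhnLabel_offset_mem m (v - m) hσ
  obtain ⟨u', hu', hequ'⟩ := kuhnLabel_offset_mem m (v' - m) hσ'
  rw [add_sub_cancel] at hequ hequ'
  have hb := hA u hu
  have hb' := hA u' hu'
  rw [← hequ] at hb
  rw [← hequ'] at hb'
  -- the reference similarity on the two labels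
  have hdiff : a • A (slabLin (1 - 2 * ((k % 2 : ℤ) : ℝ)) ((v.1 : ℝ), (v.2.1 : ℝ), (v.2.2 : ℝ))) -
      a • A (slabLin (1 - 2 * ((k % 2 : ℤ) : ℝ)) ((v'.1 : ℝ), (v'.2.1 : ℝ), (v'.2.2 : ℝ))) =
      a • A (hcpSite 1 (Real.sqrt (2 / 3)) (kuhnLabel v) - hcpSite 1 (Real.sqrt (2 / 3)) (kuhnLabel v')) := by
    rw [← slabMap_intCast v hvk, ← slabMap_intCast v' hvk', slabMap_sub, ← smul_sub, ← map_sub, ← map_sub,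
      Prod.mk_sub_mk, Prod.mk_sub_mk]
  have e : ∀ P Q R T : EuclideanSpace ℝ (Fin 3), (P - R) - (Q - T) = (P - Q) - (R - T) := fun _ _ _ _ => by abel
  rw [e, hdiff]
  have e2 : X (kuhnLabel v) - X (kuhnLabel v') -
      a • A (hcpSite 1 (Real.sqrt (2 / 3)) (kuhnLabel v) - hcpSite 1 (Real.sqrt (2 / 3)) (kuhnLabel v')) =
      (X (kuhnLabel v) - X c - a • A (hcpSite 1 (Real.sqrt (2 / 3)) (kuhnLabel v) - hcpSite 1 (Real.sqrt (2 / 3)) c)) -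
        (X (kuhnLabel v') - X c -
          a • A (hcpSite 1 (Real.sqrt (2 / 3)) (kuhnLabel v') - hcpSite 1 (Real.sqrt (2 / 3)) c)) := by
    rw [map_sub, map_sub, map_sub, smul_sub, smul_sub, smul_sub]
    abel
  rw [e2]
  calc _ ≤ ‖X (kuhnLabel v) - X c -
          a • A (hcpSite 1 (Real.sqrt (2 / 3)) (kuhnLabel v) - hcpSite 1 (Real.sqrt (2 / 3)) c)‖ +
        ‖X (kuhnLabel v') - X c -
          a • A (hcpSite 1 (Real.sqrt (2 / 3)) (kuhnLabel v') - hcpSite 1 (Real.sqrt (2 / 3)) c)‖ := norm_sub_le _ _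
    _ ≤ 758 / 10000 * a + 758 / 10000 * a := add_le_add hb hb'
    _ = 2 * (758 / 10000) * a := by ring

/-- **The core estimate on one closed slab of a good box.**  Data: a chart `X`, a frame `(a, A)` pinning the graph ball
of radius `2` around `c = kuhnLabel m` (T3 at `c`), the deviation estimate of the threshold interpolant (T1 (ii) for
`Y = X ∘ kuhnLabel`), a good box `(m, τ)` (T2).  For `p, q` whose Kuhn coordinates lie in the box and in one closed
slab `k ∈ {m₁ − 1, m₁}`: `‖(F p − F q) − a • (A p − A q)‖ ≤ (3/8) a ‖p − q‖`. [folklore] -/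
theorem slab_estimate {X : ℤ × ℤ × ℤ → EuclideanSpace ℝ (Fin 3)} {a τ : ℝ}
    {A : EuclideanSpace ℝ (Fin 3) ≃ₗᵢ[ℝ] EuclideanSpace ℝ (Fin 3)} {m : ℤ × ℤ × ℤ}
    (hest : ∀ (M : ℝ × ℝ × ℝ →ₗ[ℝ] EuclideanSpace ℝ (Fin 3)) (x y : ℝ × ℝ × ℝ) (D : ℝ), 0 ≤ D →
        (∀ t ∈ Set.Ioo (0 : ℝ) 1,
          ‖(X (kuhnLabel (⌈x.1 - t⌉, ⌈x.2.1 - t⌉, ⌈x.2.2 - t⌉)) -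
              M ((⌈x.1 - t⌉ : ℝ), (⌈x.2.1 - t⌉ : ℝ), (⌈x.2.2 - t⌉ : ℝ))) -
            (X (kuhnLabel (⌈y.1 - t⌉, ⌈y.2.1 - t⌉, ⌈y.2.2 - t⌉)) -
              M ((⌈y.1 - t⌉ : ℝ), (⌈y.2.1 - t⌉ : ℝ), (⌈y.2.2 - t⌉ : ℝ)))‖ ≤ D) →
        ‖(∫ t in (0 : ℝ)..1, X (kuhnLabel (⌈x.1 - t⌉, ⌈x.2.1 - t⌉, ⌈x.2.2 - t⌉))) -
            (∫ t in (0 : ℝ)..1, X (kuhnLabel (⌈y.1 - t⌉, ⌈y.2.1 - t⌉, ⌈y.2.2 - t⌉))) - M (x - y)‖ ≤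
          D * (|x.1 - y.1| + |x.2.1 - y.2.1| + |x.2.2 - y.2.2|))
    (hA : ∀ u ∈ ballLabels 2,
      ‖X (labelShift (kuhnLabel m) u) - X (kuhnLabel m) -
          a • A (hcpSite 1 (Real.sqrt (2 / 3)) (labelShift (kuhnLabel m) u) -
            hcpSite 1 (Real.sqrt (2 / 3)) (kuhnLabel m))‖ ≤ 758 / 10000 * a)
    (ha : 0 ≤ a) (hτ0 : 0 ≤ τ) (hτ1 : τ ≤ 1) {k : ℤ} (hk : k = m.1 ∨ k = m.1 - 1)
    {p q : EuclideanSpace ℝ (Fin 3)}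
    (hpb : (τ - 1 ≤ (kuhnInv p).1 - m.1 ∧ (kuhnInv p).1 - m.1 ≤ τ) ∧
      (τ - 1 ≤ (kuhnInv p).2.1 - m.2.1 ∧ (kuhnInv p).2.1 - m.2.1 ≤ τ) ∧
      (τ - 1 ≤ (kuhnInv p).2.2 - m.2.2 ∧ (kuhnInv p).2.2 - m.2.2 ≤ τ))
    (hqb : (τ - 1 ≤ (kuhnInv q).1 - m.1 ∧ (kuhnInv q).1 - m.1 ≤ τ) ∧
      (τ - 1 ≤ (kuhnInv q).2.1 - m.2.1 ∧ (kuhnInv q).2.1 - m.2.1 ≤ τ) ∧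
      (τ - 1 ≤ (kuhnInv q).2.2 - m.2.2 ∧ (kuhnInv q).2.2 - m.2.2 ≤ τ))
    (hp1 : (k : ℝ) ≤ p 2 / Real.sqrt (2 / 3)) (hp2 : p 2 / Real.sqrt (2 / 3) ≤ k + 1)
    (hq1 : (k : ℝ) ≤ q 2 / Real.sqrt (2 / 3)) (hq2 : q 2 / Real.sqrt (2 / 3) ≤ k + 1) :
    ‖((∫ t in (0 : ℝ)..1, X (kuhnLabel (⌈(kuhnInv p).1 - t⌉, ⌈(kuhnInv p).2.1 - t⌉, ⌈(kuhnInv p).2.2 - t⌉))) -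
        (∫ t in (0 : ℝ)..1, X (kuhnLabel (⌈(kuhnInv q).1 - t⌉, ⌈(kuhnInv q).2.1 - t⌉, ⌈(kuhnInv q).2.2 - t⌉)))) -
        a • (A p - A q)‖ ≤ 3 / 8 * a * ‖p - q‖ := by
  set s : ℝ := 1 - 2 * ((k % 2 : ℤ) : ℝ) with hs
  set x := kuhnInv p with hx
  set y := kuhnInv q with hy
  -- the reference linear map `M = a • A ∘ L_s`
  set M : ℝ × ℝ × ℝ →ₗ[ℝ] EuclideanSpace ℝ (Fin 3) :=
    a • ((A.toLinearEquiv : EuclideanSpace ℝ (Fin 3) →ₗ[ℝ] EuclideanSpace ℝ (Fin 3)).comp (slabLin s)) with hM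
  have hMapp : ∀ d, M d = a • A (slabLin s d) := fun d => by simp [hM]
  have hx1 : x.1 = p 2 / Real.sqrt (2 / 3) := rfl
  have hy1 : y.1 = q 2 / Real.sqrt (2 / 3) := rfl
  -- the integrand pairs are `2 c₂ a`-close
  have hyp : ∀ t ∈ Set.Ioo (0 : ℝ) 1,
      ‖(X (kuhnLabel (⌈x.1 - t⌉, ⌈x.2.1 - t⌉, ⌈x.2.2 - t⌉)) -
          M ((⌈x.1 - t⌉ : ℝ), (⌈x.2.1 - t⌉ : ℝ), (⌈x.2.2 - t⌉ : ℝ))) -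
        (X (kuhnLabel (⌈y.1 - t⌉, ⌈y.2.1 - t⌉, ⌈y.2.2 - t⌉)) -
          M ((⌈y.1 - t⌉ : ℝ), (⌈y.2.1 - t⌉ : ℝ), (⌈y.2.2 - t⌉ : ℝ)))‖ ≤ 2 * (758 / 10000) * a := by
    intro t ht
    obtain ⟨ht0, ht1⟩ := ht
    obtain ⟨hσ, c1, d1⟩ := offsets_of_box hτ0 hτ1 ht0 ht1 hpb _ rfl
    obtain ⟨hσ', c1', d1'⟩ := offsets_of_box hτ0 hτ1 ht0 ht1 hqb _ rfl
    -- the two label triples are vertices of the slab `k`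
    have hvk : ((⌈x.1 - t⌉, ⌈x.2.1 - t⌉, ⌈x.2.2 - t⌉) : ℤ × ℤ × ℤ).1 = k ∨
        ((⌈x.1 - t⌉, ⌈x.2.1 - t⌉, ⌈x.2.2 - t⌉) : ℤ × ℤ × ℤ).1 = k + 1 := by
      have h01 := hσ
      simp only [Prod.fst_sub, Prod.snd_sub] at h01
      simp only [Prod.fst_sub] at c1 d1
      show ⌈x.1 - t⌉ = k ∨ ⌈x.1 - t⌉ = k + 1
      rcases hk with hk | hk
      · have hk' : (k : ℝ) = m.1 := by rw [hk]
        have : 0 ≤ ⌈x.1 - t⌉ - m.1 := c1 (by rw [hx1, ← hk']; linarith)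
        rcases h01 with ⟨h, -, -⟩ | ⟨h, -, -⟩ <;> omega
      · have hk' : (k : ℝ) = m.1 - 1 := by rw [hk]; push_cast; ring
        have : ⌈x.1 - t⌉ - m.1 ≤ 0 := d1 (by rw [hx1]; linarith)
        rcases h01 with ⟨h, -, -⟩ | ⟨h, -, -⟩ <;> omega
    have hvk' : ((⌈y.1 - t⌉, ⌈y.2.1 - t⌉, ⌈y.2.2 - t⌉) : ℤ × ℤ × ℤ).1 = k ∨
        ((⌈y.1 - t⌉, ⌈y.2.1 - t⌉, ⌈y.2.2 - t⌉) : ℤ × ℤ × ℤ).1 = k + 1 := by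
      have h01 := hσ'
      simp only [Prod.fst_sub, Prod.snd_sub] at h01
      simp only [Prod.fst_sub] at c1' d1'
      show ⌈y.1 - t⌉ = k ∨ ⌈y.1 - t⌉ = k + 1
      rcases hk with hk | hk
      · have hk' : (k : ℝ) = m.1 := by rw [hk]
        have : 0 ≤ ⌈y.1 - t⌉ - m.1 := c1' (by rw [hy1, ← hk']; linarith)
        rcases h01 with ⟨h, -, -⟩ | ⟨h, -, -⟩ <;> omega
      · have hk' : (k : ℝ) = m.1 - 1 := by rw [hk]; push_cast; ring
        have : ⌈y.1 - t⌉ - m.1 ≤ 0 := d1' (by rw [hy1]; linarith)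
        rcases h01 with ⟨h, -, -⟩ | ⟨h, -, -⟩ <;> omega
    have hpair := pair_bound hA _ _ hvk hvk' hσ hσ'
    rw [hMapp, hMapp]
    exact hpair
  -- the threshold estimate
  have hT := hest M x y (2 * (758 / 10000) * a) (by positivity) hyp
  -- `M (x − y) = a • (A p − A q)` and `Σ |x_j − y_j| ≤ √6 ‖p − q‖`
  have hsub : p - q = slabLin s (x - y) := sub_eq_slabLin hp1 hp2 hq1 hq2
  have hMxy : M (x - y) = a • (A p - A q) := by
    rw [hMapp, ← hsub, map_sub]
  obtain ⟨hsum, -, -, -⟩ := abs_le_of_slabLin (slabSign_cases k) (x - y)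
  rw [← hs, ← hsub] at hsum
  rw [hMxy] at hT
  simp only [Prod.fst_sub, Prod.snd_sub] at hT hsum
  calc _ ≤ 2 * (758 / 10000) * a * (|x.1 - y.1| + |x.2.1 - y.2.1| + |x.2.2 - y.2.2|) := hT
    _ ≤ 2 * (758 / 10000) * a * (Real.sqrt 6 * ‖p - q‖) := mul_le_mul_of_nonneg_left hsum (by positivity)
    _ = (2 * (758 / 10000) * Real.sqrt 6) * a * ‖p - q‖ := by ring
    _ ≤ 3 / 8 * a * ‖p - q‖ := by
        have := two_c2_sqrt6_le
        have hn := norm_nonneg (p - q)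
        nlinarith [mul_nonneg ha hn]

end KuhnChart

/-! ## The registered stub -/

open KuhnChart in
/-- **Registered stub `stub_chartInterpolation` (T4, lead c4): a tube chart extends to a map of `ℝ³` that is locally
`3/8`-close to one-star similarities on balls of radius `1/25`.**  The map is the threshold (Kuhn–Freudenthal)
interpolant `F p = ∫₀¹ X (kuhnLabel ⌈kuhnInv p − t·(1,1,1)⌉) dt`; `F (Pᵢ u) = X u` by `kuhnInv_hcpSite` and T1 (i);
on a ball of radius `1/25` the Kuhn coordinates stay in a sup-ball of radius `√2/25 ≤ 1/16` (`norm_kuhnInv_sub_le`),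
hence in a good box `(m, τ)` (T2); the one-star frame at `kuhnLabel m` pins the graph ball of radius `2` (T3); pairs in
one closed slab are handled by `slab_estimate` (T1 (ii) + `pair_bound` + the slab Gram inequality), pairs in the two
slabs of the box by one cut at the plane between them (`exists_cut`). [folklore] -/
theorem stub_chartInterpolation :
    ∀ S : Set (EuclideanSpace ℝ (Fin 3)), (∀ x ∈ S, GoodShell S x) → HcpCharted S →
      ∀ X : ℤ × ℤ × ℤ → EuclideanSpace ℝ (Fin 3), IsRootedChart S X →
        ∃ F : EuclideanSpace ℝ (Fin 3) → EuclideanSpace ℝ (Fin 3),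
          (∀ u : ℤ × ℤ × ℤ, F (hcpSite 1 (Real.sqrt (2 / 3)) u) = X u) ∧
          ∀ y : EuclideanSpace ℝ (Fin 3), ∃ a : ℝ, 9 / 10 ≤ a ∧
            ∃ A : EuclideanSpace ℝ (Fin 3) ≃ₗᵢ[ℝ] EuclideanSpace ℝ (Fin 3),
              ∀ p ∈ Metric.ball y (1 / 25 : ℝ), ∀ q ∈ Metric.ball y (1 / 25 : ℝ),
                ‖(F p - F q) - a • (A p - A q)‖ ≤ 3 / 8 * a * ‖p - q‖ := by
  intro S hgood hch X hX
  obtain ⟨hvert, hest⟩ := stub_thresholdInterpolation (fun v => X (kuhnLabel v))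
  refine ⟨fun p => ∫ t in (0 : ℝ)..1,
      X (kuhnLabel (⌈(kuhnInv p).1 - t⌉, ⌈(kuhnInv p).2.1 - t⌉, ⌈(kuhnInv p).2.2 - t⌉)), ?_, ?_⟩
  · -- vertex values
    intro u
    have h := hvert (kuhnCoord u)
    simp only [kuhnInv_hcpSite]
    rw [kuhnLabel_kuhnCoord] at h
    exact h
  · intro y
    obtain ⟨m, τ, hτ0, hτ1, hbox⟩ := stub_goodCentre (kuhnInv y)
    obtain ⟨a, ha9, -, A, hA⟩ := stub_chartCubeFrames S hgood hch X hX (kuhnLabel m)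
    have ha0 : 0 ≤ a := by linarith
    refine ⟨a, ha9, A, ?_⟩
    -- every point of the ball is read inside the good box
    have hbx : ∀ r ∈ Metric.ball y (1 / 25 : ℝ),
        (τ - 1 ≤ (kuhnInv r).1 - m.1 ∧ (kuhnInv r).1 - m.1 ≤ τ) ∧
          (τ - 1 ≤ (kuhnInv r).2.1 - m.2.1 ∧ (kuhnInv r).2.1 - m.2.1 ≤ τ) ∧
          (τ - 1 ≤ (kuhnInv r).2.2 - m.2.2 ∧ (kuhnInv r).2.2 - m.2.2 ≤ τ) := by
      intro r hr
      refine hbox (kuhnInv r) ?_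
      have h1 : ‖r - y‖ < 1 / 25 := mem_ball_iff_norm.1 hr
      calc ‖kuhnInv r - kuhnInv y‖ ≤ Real.sqrt 2 * ‖r - y‖ := norm_kuhnInv_sub_le (by linarith)
        _ ≤ Real.sqrt 2 * (1 / 25) := mul_le_mul_of_nonneg_left h1.le (Real.sqrt_nonneg _)
        _ ≤ 1 / 16 := sqrt2_div_25_le
    have hest' : ∀ (M : ℝ × ℝ × ℝ →ₗ[ℝ] EuclideanSpace ℝ (Fin 3)) (x y : ℝ × ℝ × ℝ) (D : ℝ), 0 ≤ D →
        (∀ t ∈ Set.Ioo (0 : ℝ) 1,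
          ‖(X (kuhnLabel (⌈x.1 - t⌉, ⌈x.2.1 - t⌉, ⌈x.2.2 - t⌉)) -
              M ((⌈x.1 - t⌉ : ℝ), (⌈x.2.1 - t⌉ : ℝ), (⌈x.2.2 - t⌉ : ℝ))) -
            (X (kuhnLabel (⌈y.1 - t⌉, ⌈y.2.1 - t⌉, ⌈y.2.2 - t⌉)) -
              M ((⌈y.1 - t⌉ : ℝ), (⌈y.2.1 - t⌉ : ℝ), (⌈y.2.2 - t⌉ : ℝ)))‖ ≤ D) →
        ‖(∫ t in (0 : ℝ)..1, X (kuhnLabel (⌈x.1 - t⌉, ⌈x.2.1 - t⌉, ⌈x.2.2 - t⌉))) -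
            (∫ t in (0 : ℝ)..1, X (kuhnLabel (⌈y.1 - t⌉, ⌈y.2.1 - t⌉, ⌈y.2.2 - t⌉))) - M (x - y)‖ ≤
          D * (|x.1 - y.1| + |x.2.1 - y.2.1| + |x.2.2 - y.2.2|) :=
      fun M x y D hD h => hest M x y D hD h
    have hh := sqrt_twoThirds_pos
    intro p hp q hq
    have hpb := hbx p hp
    have hqb := hbx q hq
    -- heights relative to the box
    have hp_lo : (m.1 : ℝ) - 1 ≤ p 2 / Real.sqrt (2 / 3) := by have := hpb.1.1; rw [kuhnInv_fst] at this; linarith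
    have hp_hi : p 2 / Real.sqrt (2 / 3) ≤ m.1 + 1 := by have := hpb.1.2; rw [kuhnInv_fst] at this; linarith
    have hq_lo : (m.1 : ℝ) - 1 ≤ q 2 / Real.sqrt (2 / 3) := by have := hqb.1.1; rw [kuhnInv_fst] at this; linarith
    have hq_hi : q 2 / Real.sqrt (2 / 3) ≤ m.1 + 1 := by have := hqb.1.2; rw [kuhnInv_fst] at this; linarith
    -- the two one-slab estimates
    have upper : ∀ {p' q' : EuclideanSpace ℝ (Fin 3)}, p' ∈ Metric.ball y (1 / 25 : ℝ) → q' ∈ Metric.ball y (1 / 25 : ℝ) →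
        (m.1 : ℝ) ≤ p' 2 / Real.sqrt (2 / 3) → (m.1 : ℝ) ≤ q' 2 / Real.sqrt (2 / 3) →
        ‖((∫ t in (0 : ℝ)..1, X (kuhnLabel (⌈(kuhnInv p').1 - t⌉, ⌈(kuhnInv p').2.1 - t⌉, ⌈(kuhnInv p').2.2 - t⌉))) -
            (∫ t in (0 : ℝ)..1, X (kuhnLabel (⌈(kuhnInv q').1 - t⌉, ⌈(kuhnInv q').2.1 - t⌉, ⌈(kuhnInv q').2.2 - t⌉)))) -
            a • (A p' - A q')‖ ≤ 3 / 8 * a * ‖p' - q'‖ := by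
      intro p' q' hp' hq' h1 h2
      have hpb' := hbx p' hp'
      have hqb' := hbx q' hq'
      have e1 : p' 2 / Real.sqrt (2 / 3) ≤ m.1 + 1 := by have := hpb'.1.2; rw [kuhnInv_fst] at this; linarith
      have e2 : q' 2 / Real.sqrt (2 / 3) ≤ m.1 + 1 := by have := hqb'.1.2; rw [kuhnInv_fst] at this; linarith
      exact slab_estimate hest' hA ha0 hτ0 hτ1 (Or.inl rfl) hpb' hqb' h1 e1 h2 e2
    have lower : ∀ {p' q' : EuclideanSpace ℝ (Fin 3)}, p' ∈ Metric.ball y (1 / 25 : ℝ) → q' ∈ Metric.ball y (1 / 25 : ℝ) →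
        p' 2 / Real.sqrt (2 / 3) ≤ m.1 → q' 2 / Real.sqrt (2 / 3) ≤ m.1 →
        ‖((∫ t in (0 : ℝ)..1, X (kuhnLabel (⌈(kuhnInv p').1 - t⌉, ⌈(kuhnInv p').2.1 - t⌉, ⌈(kuhnInv p').2.2 - t⌉))) -
            (∫ t in (0 : ℝ)..1, X (kuhnLabel (⌈(kuhnInv q').1 - t⌉, ⌈(kuhnInv q').2.1 - t⌉, ⌈(kuhnInv q').2.2 - t⌉)))) -
            a • (A p' - A q')‖ ≤ 3 / 8 * a * ‖p' - q'‖ := by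
      intro p' q' hp' hq' h1 h2
      have hpb' := hbx p' hp'
      have hqb' := hbx q' hq'
      have e1 : (((m.1 - 1 : ℤ)) : ℝ) ≤ p' 2 / Real.sqrt (2 / 3) := by
        have := hpb'.1.1; rw [kuhnInv_fst] at this; push_cast; linarith
      have e2 : (((m.1 - 1 : ℤ)) : ℝ) ≤ q' 2 / Real.sqrt (2 / 3) := by
        have := hqb'.1.1; rw [kuhnInv_fst] at this; push_cast; linarith
      exact slab_estimate hest' hA ha0 hτ0 hτ1 (Or.inr rfl) hpb' hqb' e1 (by push_cast; linarith) e2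
        (by push_cast; linarith)
    -- combining two pieces along a cut
    have combine : ∀ b : EuclideanSpace ℝ (Fin 3), ‖p - b‖ + ‖b - q‖ = ‖p - q‖ →
        ‖((∫ t in (0 : ℝ)..1, X (kuhnLabel (⌈(kuhnInv p).1 - t⌉, ⌈(kuhnInv p).2.1 - t⌉, ⌈(kuhnInv p).2.2 - t⌉))) -
            (∫ t in (0 : ℝ)..1, X (kuhnLabel (⌈(kuhnInv b).1 - t⌉, ⌈(kuhnInv b).2.1 - t⌉, ⌈(kuhnInv b).2.2 - t⌉)))) -
            a • (A p - A b)‖ ≤ 3 / 8 * a * ‖p - b‖ →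
        ‖((∫ t in (0 : ℝ)..1, X (kuhnLabel (⌈(kuhnInv b).1 - t⌉, ⌈(kuhnInv b).2.1 - t⌉, ⌈(kuhnInv b).2.2 - t⌉))) -
            (∫ t in (0 : ℝ)..1, X (kuhnLabel (⌈(kuhnInv q).1 - t⌉, ⌈(kuhnInv q).2.1 - t⌉, ⌈(kuhnInv q).2.2 - t⌉)))) -
            a • (A b - A q)‖ ≤ 3 / 8 * a * ‖b - q‖ →
        ‖((∫ t in (0 : ℝ)..1, X (kuhnLabel (⌈(kuhnInv p).1 - t⌉, ⌈(kuhnInv p).2.1 - t⌉, ⌈(kuhnInv p).2.2 - t⌉))) -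
            (∫ t in (0 : ℝ)..1, X (kuhnLabel (⌈(kuhnInv q).1 - t⌉, ⌈(kuhnInv q).2.1 - t⌉, ⌈(kuhnInv q).2.2 - t⌉)))) -
            a • (A p - A q)‖ ≤ 3 / 8 * a * ‖p - q‖ := by
      intro b hlen h1 h2
      set Fp := ∫ t in (0 : ℝ)..1, X (kuhnLabel (⌈(kuhnInv p).1 - t⌉, ⌈(kuhnInv p).2.1 - t⌉, ⌈(kuhnInv p).2.2 - t⌉))
      set Fq := ∫ t in (0 : ℝ)..1, X (kuhnLabel (⌈(kuhnInv q).1 - t⌉, ⌈(kuhnInv q).2.1 - t⌉, ⌈(kuhnInv q).2.2 - t⌉))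
      set Fb := ∫ t in (0 : ℝ)..1, X (kuhnLabel (⌈(kuhnInv b).1 - t⌉, ⌈(kuhnInv b).2.1 - t⌉, ⌈(kuhnInv b).2.2 - t⌉))
      have e : (Fp - Fq) - a • (A p - A q) = ((Fp - Fb) - a • (A p - A b)) + ((Fb - Fq) - a • (A b - A q)) := by
        rw [smul_sub, smul_sub, smul_sub]; abel
      rw [e]
      calc _ ≤ ‖(Fp - Fb) - a • (A p - A b)‖ + ‖(Fb - Fq) - a • (A b - A q)‖ := norm_add_le _ _
        _ ≤ 3 / 8 * a * ‖p - b‖ + 3 / 8 * a * ‖b - q‖ := add_le_add h1 h2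
        _ = 3 / 8 * a * ‖p - q‖ := by rw [← mul_add, hlen]
    show ‖((∫ t in (0 : ℝ)..1, X (kuhnLabel (⌈(kuhnInv p).1 - t⌉, ⌈(kuhnInv p).2.1 - t⌉, ⌈(kuhnInv p).2.2 - t⌉))) -
        (∫ t in (0 : ℝ)..1, X (kuhnLabel (⌈(kuhnInv q).1 - t⌉, ⌈(kuhnInv q).2.1 - t⌉, ⌈(kuhnInv q).2.2 - t⌉)))) -
        a • (A p - A q)‖ ≤ 3 / 8 * a * ‖p - q‖
    by_cases hpu : (m.1 : ℝ) ≤ p 2 / Real.sqrt (2 / 3)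
    · by_cases hqu : (m.1 : ℝ) ≤ q 2 / Real.sqrt (2 / 3)
      · exact upper hp hq hpu hqu
      · -- `q` below the plane, `p` above: cut
        push Not at hqu
        have hz : (p 2 ≤ m.1 * Real.sqrt (2 / 3) ∧ m.1 * Real.sqrt (2 / 3) ≤ q 2) ∨
            (q 2 ≤ m.1 * Real.sqrt (2 / 3) ∧ m.1 * Real.sqrt (2 / 3) ≤ p 2) := by
          right
          constructor
          · have : q 2 / Real.sqrt (2 / 3) * Real.sqrt (2 / 3) = q 2 := by field_simp
            nlinarith
          · have : p 2 / Real.sqrt (2 / 3) * Real.sqrt (2 / 3) = p 2 := by field_simp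
            nlinarith
        obtain ⟨b, hbseg, hb2, hlen⟩ := exists_cut p q hz
        have hb : b ∈ Metric.ball y (1 / 25 : ℝ) := (convex_ball y (1 / 25 : ℝ)).segment_subset hp hq hbseg
        have hbm : b 2 / Real.sqrt (2 / 3) = m.1 := by rw [hb2]; field_simp
        exact combine b hlen (upper hp hb hpu hbm.symm.le) (lower hb hq hbm.le hqu.le)
    · push Not at hpu
      by_cases hqu : (m.1 : ℝ) ≤ q 2 / Real.sqrt (2 / 3)
      · -- `p` below the plane, `q` above: cut
        have hz : (p 2 ≤ m.1 * Real.sqrt (2 / 3) ∧ m.1 * Real.sqrt (2 / 3) ≤ q 2) ∨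
            (q 2 ≤ m.1 * Real.sqrt (2 / 3) ∧ m.1 * Real.sqrt (2 / 3) ≤ p 2) := by
          left
          constructor
          · have : p 2 / Real.sqrt (2 / 3) * Real.sqrt (2 / 3) = p 2 := by field_simp
            nlinarith
          · have : q 2 / Real.sqrt (2 / 3) * Real.sqrt (2 / 3) = q 2 := by field_simp
            nlinarith
        obtain ⟨b, hbseg, hb2, hlen⟩ := exists_cut p q hz
        have hb : b ∈ Metric.ball y (1 / 25 : ℝ) := (convex_ball y (1 / 25 : ℝ)).segment_subset hp hq hbseg
        have hbm : b 2 / Real.sqrt (2 / 3) = m.1 := by rw [hb2]; field_simp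
        exact combine b hlen (lower hp hb hpu.le hbm.le) (upper hb hq hbm.symm.le hqu)
      · push Not at hqu
        exact lower hp hq hpu.le hqu.le

end Summit.AtomisticToContinuum.Crystallization.Theorems.PalmUnimodularRigidity.LayeredLawsSelectHcp

end
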